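import Mathlib
import Summits.MatrixMultiplication.MatrixMultiplication.Theses.HiddenToeplitzCorners
import Summits.MatrixMultiplication.MatrixMultiplication.Theorems.HiddenToeplitzCornersHiddenCornersStubCorankOneStep
import Summits.MatrixMultiplication.MatrixMultiplication.Theorems.HiddenToeplitzCornersHiddenCornersStubCorankOneDense

/-!
# Crux `HiddenCorners` (stmt-MatrixMultiplication-7492) — `Lines/birth.lean`, the BC3 birth skeleton

Route `HiddenToeplitzCorners`, crux #4 `HiddenCorners` (X itself).  Decomposition along the one thesis-side
lever that survived a triage panel (crux idea `entangled-adjugate-corners`, TRIAGE-r1-1/2/3: pass ×3; both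
registered lines `Sketch` (monomial / dense-frame corners) and `ApolarSketch` (honest Hankel, δ = 2) are dead,
see `Lines/*-dead.md`): clause (iii) of the crux — "`T(X)` is singular whenever `X` is" — is certified by an
ENTANGLED ADJUGATE KERNEL, a constant `K : ℂ^(r×r) → ℂ^N` injective on the Segre cone `{v wᵀ : v, w ≠ 0}` with
`T(X) · K · vec(adj X) = 0` on `{det X = 0}`, instead of a linear corner `T(X) E = F X` (the degree-1 device,
which the negative crux `HiddenCornerLemmaR` / the conjectured law of ends `Cruxes/HiddenCorners/LawOfEnds.lean`
obstructs at generator length `d = r^(o(1))`; every no-go on record for this crux is a degree-1 statement).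

* `stub_corank_one_step`  (LANDED p159135, wave 1 of lead c1) — on the corank-one stratum `rank X + 1 = r` the adjugate is a
  nonzero rank-one matrix `v wᵀ` (`X v = 0`, `wᵀ X = 0`), so Segre-injectivity of `K` makes `K · vec(adj X)` a
  NONZERO kernel vector of `T(X)`; hence `det T(X) = 0` there.
* `stub_corank_one_dense` (LANDED p159082, wave 1 of lead c1) — for a linear pencil, `det T(X) = 0` on the corank-one stratum forces
  `det T(X) = 0` on every singular `X`: a singular `X` of rank `k ≤ r - 2` is `lim_{t → 0} (X + tY)` with
  `rank (X + tY) = r - 1`, `det (X + tY) = 0` for `t ≠ 0` (rank normal form), and `t ↦ det T(X + tY)` is continuous.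
* `stub_adjugate_family`  (XL, OPEN — the line's bet; the card's transfer target C⁺ = `HiddenAdjugateCorners`) — for
  every `ε > 0` and infinitely many `r`: a pencil inside the crux's budget (split Stein generators of length
  `d ≤ r^ε`, generator sparsity `≤ r^(2+ε)`, size `N ≤ r^(2+ε)`), generically nonsingular, carrying an entangled
  adjugate kernel `K`.  Why easier than (iii) itself: for FIXED `K` the kernel identity is a system of polynomial
  identities LINEAR in the placement `T`, satisfied identically by the natural families (adjugate pencils
  `M ↦ Σ_k A_k X M B_k + C_k M X D_k` on `M_r`, `N = r²`), so the remaining question is the displacement structure of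
  an explicit family up to constant two-sided equivalence — not a search for frames.

`HiddenCorners_of` composes the three stubs into the crux BY NAME with a real proof (no `sorry` outside `stub_*`;
`closed = false` only through the stubs).  Disproof used: no `Disproof.lean` exists for this crux;
`LawOfEnds.splitNeutralLaw_refutes` (proved bridge, law itself open) would refute `stub_adjugate_family` together
with the crux — that is the bet, recorded.  NEGATIVE LEMMAS LANDED BY THE LEAD (c1) AGAINST THE STUB'S MECHANISM:
`Theorems/HiddenCorners/Negative/KroneckerNeutralCore.lean` (p160705) + `…/KroneckerNeutral.lean`: the card's flagship
family `P (X ⊗ 1ₙ) Q` has split width `≥ r − 1` in EVERY basis (crux-literal form included), so it can never witness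
`stub_adjugate_family` at `d ≤ r − 2`; paper theorems 2, 3 of `Cruxes/HiddenCorners/KroneckerNeutral.md` do the same for
the adjugate pencil `M ↦ XM + MX` (`≥ r − 2`) and the Kronecker sum / Lyapunov pencil (`≥ r − 4` / `≥ r − 2`).
-/

set_option linter.dupNamespace false

namespace Summit.MatrixMultiplication.MatrixMultiplication.Cruxes.HiddenCorners.Birth

open Summit.MatrixMultiplication.MatrixMultiplication.Theses.HiddenToeplitzCorners
open scoped BigOperators Matrix

/- STUBS 1 and 2 LANDED (wave 1, lead c1): `stub_corank_one_step` = Theorems/HiddenToeplitzCornersHiddenCornersStubCorankOneStep.lean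
   (p159135), `stub_corank_one_dense` = Theorems/HiddenToeplitzCornersHiddenCornersStubCorankOneDense.lean (p159082); both are
   imported above under their registered names and consumed by `HiddenCorners_of` below. -/

/-- STUB 3 — the entangled-adjugate family (C⁺ = `HiddenAdjugateCorners`, the OPEN load-bearing stub): for every
`ε > 0` and infinitely many `r` there is a pencil `T : M_r(ℂ) → M_N(ℂ)`, `N ≤ r^(2+ε)`, with split Stein generators
`T_ab - Z T_ab Zᵀ = G₀ (H₁)_abᵀ + (G₁)_ab H₀ᵀ` of length `d ≤ r^ε` and total generator sparsity `≤ r^(2+ε)`,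
nonsingular at some `X₀`, together with a Segre-injective `K : ℂ^(r×r) → ℂ^N` such that `K · vec(adj X)` is a
kernel vector of `T(X)` for every singular `X`. -/
theorem stub_adjugate_family :
    ∀ ε : ℝ, 0 < ε → ∃ᶠ r : ℕ in Filter.atTop, ∃ (N d : ℕ), (N : ℝ) ≤ (r : ℝ) ^ (2 + ε) ∧
      (d : ℝ) ≤ (r : ℝ) ^ ε ∧
      ∃ (T : Fin r → Fin r → Matrix (Fin N) (Fin N) ℂ) (G₀ H₀ : Matrix (Fin N) (Fin d) ℂ)
        (G₁ H₁ : Fin r → Fin r → Matrix (Fin N) (Fin d) ℂ),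
        (∀ a b, T a b - (Matrix.of fun i j : Fin N => if (i : ℕ) = (j : ℕ) + 1 then (1 : ℂ) else 0) * T a b *
            (Matrix.of fun i j : Fin N => if (i : ℕ) = (j : ℕ) + 1 then (1 : ℂ) else 0)ᵀ
              = G₀ * (H₁ a b)ᵀ + G₁ a b * H₀ᵀ) ∧
        ((∑ a : Fin r, ∑ b : Fin r,
            ((Finset.univ.filter fun p : Fin N × Fin d => G₁ a b p.1 p.2 ≠ 0).card +
              (Finset.univ.filter fun p : Fin N × Fin d => H₁ a b p.1 p.2 ≠ 0).card) : ℕ) : ℝ)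
            ≤ (r : ℝ) ^ (2 + ε) ∧
        (∃ X₀ : Matrix (Fin r) (Fin r) ℂ, (∑ a : Fin r, ∑ b : Fin r, X₀ a b • T a b).det ≠ 0) ∧
        ∃ K : Matrix (Fin N) (Fin r × Fin r) ℂ,
          (∀ v w : Fin r → ℂ, v ≠ 0 → w ≠ 0 →
            Matrix.mulVec K (fun p : Fin r × Fin r => v p.1 * w p.2) ≠ 0) ∧
          ∀ X : Matrix (Fin r) (Fin r) ℂ, X.det = 0 →
            Matrix.mulVec (∑ a : Fin r, ∑ b : Fin r, X a b • T a b)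
              (Matrix.mulVec K fun p : Fin r × Fin r => X.adjugate p.1 p.2) = 0 := by
  sorry

/-- COMPOSITION (real proof, no `sorry` of its own): the corank-one step and the density step turn the entangled
adjugate kernel of the family into clause (iii); size, generators, sparsity and the nonsingular value are carried
over verbatim — the crux `HiddenCorners` BY NAME.  `closed = false` only through the three `stub_*`. -/
theorem HiddenCorners_of : HiddenCorners := by
  intro ε hε
  refine (stub_adjugate_family ε hε).mono ?_
  rintro r ⟨N, d, hN, hd, T, G₀, H₀, G₁, H₁, hdisp, hsp, hX₀, K, hK, hker⟩
  exact ⟨N, d, hN, hd, T, G₀, H₀, G₁, H₁, hdisp, hsp, hX₀,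
    fun X hX => stub_corank_one_dense r N T (stub_corank_one_step r N T K hK hker) X hX⟩

end Summit.MatrixMultiplication.MatrixMultiplication.Cruxes.HiddenCorners.Birth
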